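import Summits.QuantumFields.BalabanUV.Beta.D1BFx.NeedleNdlProjRow

/-!
# `BalabanUV.Beta.D1BFx.NeedleProjNdlRow` — road «BF-x» for binder row D1, slot (K), END row `hGrp gN`, «GN-33 ∕ PN»: THE `projPiece ⊗ ndlPiece` CELL OF THE
# GLUON NEEDLE ROW T₃ IS n-UNIFORM — `|cellSum n a (projPiece n a) (ndlPiece n a (cQ n)) μ ν| ≤ C_PN` for every `n ≥ 1`, ONE `C_PN = C(a, cQ₀) ≥ 0`, modulo
# [B5, Prop. 1.2] ∧ [B5, (1.126)–(1.127)] BY NAME and `|cQ n| ≤ cQ₀` (P13) — the hypothesis `hpn` of `GluonNeedleGlue.h₃_of_cells`; the needle now sits at the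
# BASE bond `(b, ν)`, so the census is paid at the BASE AVERAGE (an3-g57 `N36-SPLIT.v1.md` §3′ (4) R1⊗R3: «`k·n^{λ−6}` ⇒ × `n⁶` × `n^{−λ}` (R3 at the base): n⁰»)

HONEST DEPENDENCY (cell records, verbatim): «continuum YM on T⁴ ⇐ BetaPertH ∧ nine spine estimates (0/9 proved); BetaPertH ⇐ (D1) ∧ (D4) ∧
CAP+tail; G-an2-4 gates asym, D1 and NE2/3/4.»  HONEST FRAMING (cell contract, verbatim): «discharging `BetaPertH` makes Bałaban's UV stability
UNCONDITIONAL — a real constructive-QFT result; it is NOT the continuum limit and NOT the Clay problem.»  THIS MODULE DISCHARGES NOTHING of the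
wall: [folklore] lattice bookkeeping BY NAME over `NeedleNdlProjRow.abs_ndlProj_word_le` (this seat, p266200) through leaf-03's `FineHessianSectors.biBubbleTable_transpose`,
the owner's column letters `NeedleColumnLetters` (p264178) and word shape `NeedleNdlShape`, this seat's needle letters `NeedleNdlProjLetters` (p265489), gan24-leaf-05-g41's
bond marginal `NeedleBondMarginal.sum_bond_abs_qJet_le` (M7) and `NeedleGhostBubble2Row.tsum_weight_le_of_blockDecay_mass`, leaf-04-g8's `NeedleGhostTadpoleRowSharp.blk_resSite`,
leaf-04-g9's `LatticeHLSProfiles.sum_pow_mul_exp_div_nrm_pow_free_scale_le` ∕ `LatticeHLSPairing.abs_fullSum_le_of_abs_sum_le`, and `GluonNeedleGlue.cellSum_def`.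
No `def`, no `def … : Prop`, nothing cited, 0 sorry; the printed statements are HYPOTHESES by name.  Root-level binders hW ∕ hR-sockets ∕ hSX-socket ∕ D1Tel ∕ D1Rep — 0
discharged; (K) NOT closed (T₃: 3∕9 cells with PP p261786, NP p266200; T₁∕T₂ 0∕6); NOT D1, NOT `BetaPertH`, NOT continuum, NOT Clay.

ABSOLUTE RULE (cell charter, verbatim): «No internally-minted statement may enter as a cited fact. Every hypothesis is either kernel-proved in
this package or a verbatim quotation of a PUBLISHED theorem with page reference. The manuscript(s) under audit are NOT citable for their own
disputed steps — they are the thing under adjudication; programme-internal (2001/route/tribunal) claims are never citable.»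

WHY (owner claim table «GN-CELLS» = `HOME/b2b-balaban-beta-d1-p2/GLUON-NEEDLE-ROWS.md` v0.2, cell PN; MINE journal 2026-08-21T11:09Z l.30690 «then PN by the mirror»;
RULING ρ-g10-7 l.30753).  The `proj ⊗ ndl` word at `(b+w, b)` is, by the cyclicity of the trace (`biBubbleTable_transpose`), the `ndl ⊗ proj` word at `(b, b+w)` with
the indices exchanged, so the NP pointwise bound applies verbatim with the NEEDLE AT THE BASE bond `b`: `|word(b,w)| ≤ ½e^{δ}·e^{−δD}·Σ_{s∈B(blk b)}|qJet_b s|·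
(A₀ + B₀·e^{−(ε₀∕n)‖b+w−s‖}∕nrm(b+w−s))`, `A₀ = (K₅+K₆)KGC ≍ n⁻³`, `B₀ = (K₃+K₄)KΦ ≍ n⁻²`.  The base needle weight `q_b = Σ_s|qJet_b s|` no longer sits under the
`w`-sum: the weighted `w`-sums are `Σ_w|w_μw_ν|e^{−δD} ≍ n⁶` (unit block mass) and `Σ_w|w_μw_ν|·e^{−(ε₀∕n)‖b+w−s‖}∕nrm(b+w−s) ≤ 2c₂n⁵ + 2n²c₀n³` (`|w|² ≤ 2‖b+w−s‖² + 2n²`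
inside the base block), so ONE base site costs `q_b·n³·G₀` — NOT n-uniform by itself (a level-3 needle bond has `q_b ≍ 1`); the base AVERAGE pays: over the residue
sites of the root block `Σ_{b} q_b ≤ n⁴·(n−1)n⁻⁴` (M7), hence `n⁻⁴·n³·G₀·(n−1) ≤ G₀`: n⁰ with NO cancellation — the «× n^{−λ}» of §3′ (4) for the R3-at-the-base placement,
realised by the bond marginal instead of a level census.

CONTENT (`a > 0`, `n ≥ 1`).
* §1 [folklore] **`abs_projNdl_word_le`** — the pointwise bound from ABSTRACT letters (= `NeedleNdlProjRow.abs_ndlProj_word_le` at `(ν, μ, b+w, −w)` after `biBubbleTable_transpose`).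
* §2 [folklore] `abs_weight_le_of_mem_B` (`|w_μw_ν| ≤ 2‖b+w−s‖∞² + 2n²` for `s ∈ B(blk b)`), **`abs_fullSum_projNdl_le`** — the (1.22) sum at one base site from abstract letters:
  `|fullSum_b| ≤ q_b·(½e^{δ})·((K₅+K₆)KGC·(n²((1+4∕δ)²(n⁴K₄(δ∕2)))) + (K₃+K₄)KΦ·(2c₂n⁵ + 2n²c₀n³))`.
* §3 [folklore] `sum_resSite_needle_weight_le` (THE BASE-AVERAGE CENSUS `Σ_{b∈image resSite}Σ_{s∈B(blk b)}|qJet_b s| ≤ n − 1`), **`exists_projNdl_row_le`** —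
  `∃ C ≥ 0, ∀ n [NeZero n], |cellSum n a (projPiece n a) (ndlPiece n a (cQ n)) μ ν| ≤ C` modulo `h12`∕`h126` and `hcQ` (letters instantiated as in NP; `G_n = n³·G₀` by `field_simp`;
  `n⁻⁴·n³·G₀·(n−1) = ((n−1)∕n)·G₀ ≤ G₀`).
NOT HERE (honest): the dipole cells (NK∕KN∕KK∕PK∕KP), NN; T₁∕T₂; the `h₃` glue (owner).
Unit `b2b-balaban-beta-d1-formalise-leaf-01` (gen 15), D1 formalisation swarm LEAF PROVER 01 on cross-road kernel duty; `LEAVES-BFx.md` row (N) «GN-33∕PN».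
-/

noncomputable section

namespace Summit.QuantumFields.BalabanUV.Beta.D1BFx.NeedleProjNdlRow

open Finset
open scoped BigOperators
open Literature.MathematicalPhysics.QuantumFieldTheory.Balaban1983to89
open Literature.MathematicalPhysics.QuantumFieldTheory.Balaban1983to89.Beta
open B4Sect5Proof (latticeConst latticeConst_nonneg)
open B6QGQLower276 (X e blk B mem_B)
open B6QGQDecay237 (card_B)
open ExpKernelCalculus (Site MKer Decays)
open DyadicShell (Pt toReal toReal_apply)
open Beta.PoissonInterior (nrm nrm_pos one_le_nrm nrm_neg supNorm_le_nrm)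
open WindowIdentification (fullSum)
open DressedMomentNormalisation (resSite)
open AffineAveraging (unitVec)
open VectorTailsLoc (fam kfam)
open Summit.QuantumFields.BalabanUV.Beta.TameKernelCalculus (Spr)
open Summit.QuantumFields.BalabanUV.Beta.D1BFx.FineHessianSectors (biBubbleTable biBubbleTable_transpose)
open Summit.QuantumFields.BalabanUV.Beta.D1BFx.RProjector (Pgt kerP)
open Summit.QuantumFields.BalabanUV.Beta.D1BFx.ProjectorSupNorm (cPPs cPs cPPs_nonneg cPs_nonneg)
open Summit.QuantumFields.BalabanUV.Beta.D1BFx.GluonLeg (Ga)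
open Summit.QuantumFields.BalabanUV.Beta.D1BFx.GluonLegTails (spr_Ga_of_prop12)
open Summit.QuantumFields.BalabanUV.Beta.D1BFx.FrozenLegTails (nOf MOf hn1)
open Summit.QuantumFields.BalabanUV.Beta.D1BFx.GhostLeg (cast_pred_add_one)
open Summit.QuantumFields.BalabanUV.Beta.D1BFx.GhostStencil (qJet)
open Summit.QuantumFields.BalabanUV.Beta.D1BFx.GluonNeedleSplit (projPiece ndlPiece)
open Summit.QuantumFields.BalabanUV.Beta.D1BFx.RankOneBubble (applyK applyKT pairing)
open Summit.QuantumFields.BalabanUV.Beta.D1BFx.RankOneBubbleJets (grad colGrad rowGrad)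
open Summit.QuantumFields.BalabanUV.Beta.D1BFx.NeedlePotentialLetters (ndlRow)
open Summit.QuantumFields.BalabanUV.Beta.D1BFx.NeedleNdlProjLetters (exists_applyK_grad_row_le exists_pairing_grad_row_applyK_colGrad_le
  exists_pairing_applyK_grad_row_rowGrad_le)
open Summit.QuantumFields.BalabanUV.Beta.D1BFx.NeedleColumnLetters (exists_applyK_gradC_le exists_pairing_applyK_gradC_rowGrad_le exists_pairing_gradC_applyK_colGrad_le)
open Summit.QuantumFields.BalabanUV.Beta.D1BFx.NeedleNdlProjRow (abs_ndlProj_word_le)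
open Summit.QuantumFields.BalabanUV.Beta.D1BFx.GluonNeedleGlue (cellSum cellSum_def exists_biLoc_projPiece exists_biLoc_ndlPiece)
open Summit.QuantumFields.BalabanUV.Beta.D1BFx.NeedleGhostBubble2Row (tsum_weight_le_of_blockDecay_mass)
open Summit.QuantumFields.BalabanUV.Beta.D1BFx.NeedleGhostTadpoleRowSharp (blk_resSite)
open Summit.QuantumFields.BalabanUV.Beta.D1BFx.NeedleProjProjRow (abs_weight_le_sq)
open Summit.QuantumFields.BalabanUV.Beta.D1BFx.RColumnProfile (nrm_sub_le)
open Summit.QuantumFields.BalabanUV.Beta.D1BFx.LatticeHLSPairing (abs_fullSum_le_of_abs_sum_le)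

variable (n : ℕ) [NeZero n] (a : ℝ)

/-! ## §1 The pointwise bound of the `proj ⊗ ndl` word (the transpose of `NeedleNdlProjRow.abs_ndlProj_word_le`) -/

/-- [folklore] **THE `proj ⊗ ndl` WORD, POINTWISE, FROM ABSTRACT LETTERS** (projector jet at the partner bond `(b+w, μ)`, needle at the BASE `(b, ν)`): by
`FineHessianSectors.biBubbleTable_transpose` the word is the `ndl ⊗ proj` word with the two bonds exchanged, so `abs_ndlProj_word_le` at `(ν, μ, b+w, −w)` gives
`|word(b,w)| ≤ ½e^{δ}·e^{−δ·dist(blk(b+w), blk b)}·Σ_{s∈B(blk b)} |qJet_b s|·((K₅+K₆)·KGC + (K₃+K₄)·KΦ·e^{−ε‖b+w−s‖}∕nrm(b+w−s))` — the needle weights are now those of the BASE bond. -/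
theorem abs_projNdl_word_le (ha : 0 < a) (hA : Spr (Ga n a)) {cQ KGC KΦ K₃ K₄ K₅ K₆ δ ε : ℝ}
    (hKGC : 0 ≤ KGC) (hKΦ : 0 ≤ KΦ) (hK₃ : 0 ≤ K₃) (hK₄ : 0 ≤ K₄) (hK₅ : 0 ≤ K₅) (hK₆ : 0 ≤ K₆) (hδ : 0 ≤ δ)
    (hGC : ∀ (u x : Pt) (α : Fin 4), |applyK (Ga n a)
        (grad (fun q => cQ * (∑ z ∈ B (n - 1) (blk (n - 1) u), Pgt n a z q () ()) - kerP (d := 4) (n - 1) a q (blk (n - 1) u))) x α|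
      ≤ KGC * Real.exp (-(δ * dist (blk (n - 1) x) (blk (n - 1) u))))
    (hΦ : ∀ (κ : Fin 4) (u x : Pt) (α : Fin 4), |applyK (Ga n a) (grad (ndlRow n a κ u)) x α|
      ≤ KΦ * ∑ s ∈ B (n - 1) (blk (n - 1) u), |qJet n κ u (blk (n - 1) u) s|
          * (Real.exp (-ε * PoissonInterior.supNorm (d := 4) (x - s)) / nrm (x - s) ^ 1))
    (h₃ : ∀ (u q : Pt), |pairing (grad (fun q' => cQ * (∑ z ∈ B (n - 1) (blk (n - 1) u), Pgt n a z q' () ()) - kerP (d := 4) (n - 1) a q' (blk (n - 1) u)))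
        (applyK (Ga n a) (colGrad (Pgt n a) q))| ≤ K₃ * Real.exp (-(δ * dist (blk (n - 1) q) (blk (n - 1) u))))
    (h₄ : ∀ (u p : Pt), |pairing (applyK (Ga n a)
        (grad (fun q' => cQ * (∑ z ∈ B (n - 1) (blk (n - 1) u), Pgt n a z q' () ()) - kerP (d := 4) (n - 1) a q' (blk (n - 1) u))))
        (rowGrad (Pgt n a) p)| ≤ K₄ * Real.exp (-(δ * dist (blk (n - 1) p) (blk (n - 1) u))))
    (h₅ : ∀ (κ : Fin 4) (u q : Pt), |pairing (grad (ndlRow n a κ u)) (applyK (Ga n a) (colGrad (Pgt n a) q))|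
      ≤ K₅ * ∑ s ∈ B (n - 1) (blk (n - 1) u), |qJet n κ u (blk (n - 1) u) s|)
    (h₆ : ∀ (κ : Fin 4) (u p : Pt), |pairing (applyK (Ga n a) (grad (ndlRow n a κ u))) (rowGrad (Pgt n a) p)|
      ≤ K₆ * ∑ s ∈ B (n - 1) (blk (n - 1) u), |qJet n κ u (blk (n - 1) u) s|)
    (μ ν : Fin 4) (b w : Pt) :
    |biBubbleTable (Ga n a) (Ga n a) (projPiece n a) (ndlPiece n a cQ) μ ν (b + w) b|
      ≤ (1 / 2) * Real.exp δ * Real.exp (-(δ * dist (blk (n - 1) (b + w)) (blk (n - 1) b))) *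
          ∑ s ∈ B (n - 1) (blk (n - 1) b), |qJet n ν b (blk (n - 1) b) s| *
            ((K₅ + K₆) * KGC + (K₃ + K₄) * KΦ * (Real.exp (-ε * PoissonInterior.supNorm (d := 4) (b + w - s)) / nrm (b + w - s) ^ 1)) := by
  obtain ⟨Cp, δp, hδp, hP⟩ := exists_biLoc_projPiece n a ha
  obtain ⟨Cn, δn, hδn, hN⟩ := exists_biLoc_ndlPiece n a ha cQ
  rw [biBubbleTable_transpose (A := Ga n a) (B := Ga n a) hA hA hP hδp hN hδn μ ν (b + w) b]
  have h := abs_ndlProj_word_le n a ha hA hKGC hKΦ hK₃ hK₄ hK₅ hK₆ hδ hGC hΦ h₃ h₄ h₅ h₆ ν μ (b + w) (-w)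
  have e : b + w + -w = b := by abel
  rw [e] at h
  exact h

/-! ## §2 The (1.22) sum at one base site: the needle weight of the BASE bond comes out, the `w`-sum is `O(n³)·(letters)` -/

/-- [folklore] the weight against a base-block site: for `s ∈ B(blk b)`, `|w_μ·w_ν| ≤ 2·‖b+w−s‖∞² + 2·n²` (`‖w‖∞ ≤ ‖b+w−s‖∞ + ‖s−b‖∞`, `‖s−b‖∞ ≤ nrm(s−b) ≤ n` inside one block). -/
theorem abs_weight_le_of_mem_B (b w s : Pt) (hs : s ∈ B (n - 1) (blk (n - 1) b)) (μ ν : Fin 4) :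
    |toReal w μ * toReal w ν| ≤ 2 * (PoissonInterior.supNorm (d := 4) (b + w - s) : ℝ) ^ 2 + 2 * (n : ℝ) ^ 2 := by
  have h1 := abs_weight_le_sq w μ ν
  rw [LatticeHLSProfiles.supNorm_dyadic] at h1
  have h2 : (PoissonInterior.supNorm (d := 4) w : ℝ) ≤ PoissonInterior.supNorm (d := 4) (b + w - s) + PoissonInterior.supNorm (d := 4) (s - b) := by
    have h := PoissonInterior.supNorm_add_le (d := 4) (b + w - s) (s - b)
    rw [show b + w - s + (s - b) = w by abel] at h
    exact_mod_cast h
  have h3 : (PoissonInterior.supNorm (d := 4) (s - b) : ℝ) ≤ n := by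
    have h4 := nrm_sub_le n s b
    rw [mem_B.1 hs, dist_self, zero_add, mul_one] at h4
    exact (supNorm_le_nrm _).trans h4
  have h0 : (0 : ℝ) ≤ PoissonInterior.supNorm (d := 4) (b + w - s) := by positivity
  have hn : (0 : ℝ) ≤ n := by positivity
  nlinarith [h1, h2, h3, h0, hn, sq_nonneg ((PoissonInterior.supNorm (d := 4) (b + w - s) : ℝ) - n)]

/-- [folklore] **THE (1.22) SUM OF THE `proj ⊗ ndl` WORD AT ONE BASE SITE, FROM ABSTRACT LETTERS** (`δ > 0`, needle profile damped at rate `ε₀∕n`): for every base site `b`,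
`|fullSum (w ↦ w_μw_ν·word(b,w))| ≤ (Σ_{s∈B(blk b)} |qJet_b s|)·G`, `G = ½e^{δ}·((K₅+K₆)KGC·(n²((1+4∕δ)²(n⁴K₄(δ∕2)))) + (K₃+K₄)KΦ·(2·c₂·n⁵ + 2n²·c₀·n³))` — the BASE bond's needle
weight is a common factor; the `w`-sum of the block-decay term is gan24-leaf-05's `tsum_weight_le_of_blockDecay_mass` with unit mass, that of the profile term leaf-04-g9's damped moments
`sum_pow_mul_exp_div_nrm_pow_free_scale_le` (`q = 2`, `q = 0`; `p = 1`). -/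
theorem abs_fullSum_projNdl_le (ha : 0 < a) (hA : Spr (Ga n a)) {cQ KGC KΦ K₃ K₄ K₅ K₆ δ ε₀ : ℝ}
    (hKGC : 0 ≤ KGC) (hKΦ : 0 ≤ KΦ) (hK₃ : 0 ≤ K₃) (hK₄ : 0 ≤ K₄) (hK₅ : 0 ≤ K₅) (hK₆ : 0 ≤ K₆) (hδ : 0 < δ) (hε₀ : 0 < ε₀)
    (hGC : ∀ (u x : Pt) (α : Fin 4), |applyK (Ga n a)
        (grad (fun q => cQ * (∑ z ∈ B (n - 1) (blk (n - 1) u), Pgt n a z q () ()) - kerP (d := 4) (n - 1) a q (blk (n - 1) u))) x α|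
      ≤ KGC * Real.exp (-(δ * dist (blk (n - 1) x) (blk (n - 1) u))))
    (hΦ : ∀ (κ : Fin 4) (u x : Pt) (α : Fin 4), |applyK (Ga n a) (grad (ndlRow n a κ u)) x α|
      ≤ KΦ * ∑ s ∈ B (n - 1) (blk (n - 1) u), |qJet n κ u (blk (n - 1) u) s|
          * (Real.exp (-(ε₀ / n) * PoissonInterior.supNorm (d := 4) (x - s)) / nrm (x - s) ^ 1))
    (h₃ : ∀ (u q : Pt), |pairing (grad (fun q' => cQ * (∑ z ∈ B (n - 1) (blk (n - 1) u), Pgt n a z q' () ()) - kerP (d := 4) (n - 1) a q' (blk (n - 1) u)))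
        (applyK (Ga n a) (colGrad (Pgt n a) q))| ≤ K₃ * Real.exp (-(δ * dist (blk (n - 1) q) (blk (n - 1) u))))
    (h₄ : ∀ (u p : Pt), |pairing (applyK (Ga n a)
        (grad (fun q' => cQ * (∑ z ∈ B (n - 1) (blk (n - 1) u), Pgt n a z q' () ()) - kerP (d := 4) (n - 1) a q' (blk (n - 1) u))))
        (rowGrad (Pgt n a) p)| ≤ K₄ * Real.exp (-(δ * dist (blk (n - 1) p) (blk (n - 1) u))))
    (h₅ : ∀ (κ : Fin 4) (u q : Pt), |pairing (grad (ndlRow n a κ u)) (applyK (Ga n a) (colGrad (Pgt n a) q))|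
      ≤ K₅ * ∑ s ∈ B (n - 1) (blk (n - 1) u), |qJet n κ u (blk (n - 1) u) s|)
    (h₆ : ∀ (κ : Fin 4) (u p : Pt), |pairing (applyK (Ga n a) (grad (ndlRow n a κ u))) (rowGrad (Pgt n a) p)|
      ≤ K₆ * ∑ s ∈ B (n - 1) (blk (n - 1) u), |qJet n κ u (blk (n - 1) u) s|)
    (μ ν : Fin 4) (b : Pt) :
    |fullSum (fun w : Pt => toReal w μ * toReal w ν * biBubbleTable (Ga n a) (Ga n a) (projPiece n a) (ndlPiece n a cQ) μ ν (b + w) b)|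
      ≤ (∑ s ∈ B (n - 1) (blk (n - 1) b), |qJet n ν b (blk (n - 1) b) s|) *
        ((1 / 2 * Real.exp δ) * (((K₅ + K₆) * KGC) * ((n : ℝ) ^ 2 * ((1 + 4 / δ) ^ 2 * ((n : ℝ) ^ 4 * latticeConst 4 (δ / 2))))
          + ((K₃ + K₄) * KΦ) * (2 * (2 * (Nat.factorial 2) * (2 / ε₀) ^ 2 *
              (1 + 2 * (4 : ℕ) * 3 ^ (4 - 1) * ((Nat.factorial (4 - 1 - 1)) * (4 / ε₀) ^ (4 - 1 - 1) * (1 + 4 / ε₀))) * (n : ℝ) ^ 5)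
            + 2 * (n : ℝ) ^ 2 * (2 * (Nat.factorial 0) * (2 / ε₀) ^ 0 *
              (1 + 2 * (4 : ℕ) * 3 ^ (4 - 1) * ((Nat.factorial (4 - 1 - 1)) * (4 / ε₀) ^ (4 - 1 - 1) * (1 + 4 / ε₀))) * (n : ℝ) ^ 3)))) := by
  have hn : (0 : ℝ) < n := by exact_mod_cast Nat.pos_of_ne_zero (NeZero.ne n)
  have hn1 : 1 ≤ n := NeZero.one_le
  set m : ℕ := n - 1 with hm
  set A₀ : ℝ := (K₅ + K₆) * KGC with hA₀
  set B₀ : ℝ := (K₃ + K₄) * KΦ with hB₀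
  have hA₀0 : 0 ≤ A₀ := by positivity
  have hB₀0 : 0 ≤ B₀ := by positivity
  set c₂ : ℝ := 2 * (Nat.factorial 2) * (2 / ε₀) ^ 2 *
    (1 + 2 * (4 : ℕ) * 3 ^ (4 - 1) * ((Nat.factorial (4 - 1 - 1)) * (4 / ε₀) ^ (4 - 1 - 1) * (1 + 4 / ε₀))) with hc₂
  set c₀ : ℝ := 2 * (Nat.factorial 0) * (2 / ε₀) ^ 0 *
    (1 + 2 * (4 : ℕ) * 3 ^ (4 - 1) * ((Nat.factorial (4 - 1 - 1)) * (4 / ε₀) ^ (4 - 1 - 1) * (1 + 4 / ε₀))) with hc₀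
  set Wq : Pt → ℝ := fun s => |qJet n ν b (blk m b) s| with hWq
  set E : Pt → ℝ := fun w => Real.exp (-(δ * dist (blk m (b + w)) (blk m b))) with hE
  set prof : Pt → Pt → ℝ := fun w s => Real.exp (-(ε₀ / n) * PoissonInterior.supNorm (d := 4) (b + w - s)) / nrm (b + w - s) ^ 1 with hprof
  have hprof0 : ∀ w s, 0 ≤ prof w s := fun w s => div_nonneg (Real.exp_pos _).le (pow_nonneg (nrm_pos _).le 1)
  have hE1 : ∀ w, E w ≤ 1 := fun w => by
    rw [hE]; show Real.exp _ ≤ 1; rw [Real.exp_le_one_iff]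
    have : 0 ≤ δ * dist (blk m (b + w)) (blk m b) := by positivity
    linarith
  -- term 1: the weighted block-decay sum (unit mass)
  set T₁ : ℝ := (n : ℝ) ^ 2 * ((1 + 4 / δ) ^ 2 * ((n : ℝ) ^ 4 * latticeConst 4 (δ / 2))) with hT₁
  obtain ⟨hsum1, htsum1⟩ := tsum_weight_le_of_blockDecay_mass n (f := E) (F := fun _ => (1 : ℝ)) (M := 1) zero_le_one hδ (fun _ => zero_le_one)
    (fun β' => by rw [Finset.sum_const, nsmul_eq_mul, mul_one, card_B, cast_pred_add_one n]) b μ ν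
    (fun w => by rw [hE, abs_of_nonneg (Real.exp_pos _).le, one_mul, mul_one])
  rw [one_mul] at htsum1
  have hS1 : ∀ S : Finset Pt, ∑ w ∈ S, |toReal w μ * toReal w ν| * E w ≤ T₁ := fun S => by
    have h1 : ∑ w ∈ S, |toReal w μ * toReal w ν * E w| ≤ T₁ := (hsum1.sum_le_tsum S (fun w _ => abs_nonneg _)).trans htsum1
    refine le_trans (le_of_eq (Finset.sum_congr rfl fun w _ => ?_)) h1
    rw [abs_mul (toReal w μ * toReal w ν) (E w), abs_of_nonneg (Real.exp_pos _).le]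
  -- term 2: the weighted damped profile sum
  have hS2 : ∀ (S : Finset Pt) (s : Pt), s ∈ B m (blk m b) →
      ∑ w ∈ S, |toReal w μ * toReal w ν| * prof w s ≤ 2 * (c₂ * (n : ℝ) ^ 5) + 2 * (n : ℝ) ^ 2 * (c₀ * (n : ℝ) ^ 3) := by
    intro S s hs
    have hq := LatticeHLSProfiles.sum_pow_mul_exp_div_nrm_pow_free_scale_le (d := 4) (by norm_num) hε₀ hn1 (p := 1) (by norm_num) 2
      (S.map (addLeftEmbedding b)) s s
    have h0 := LatticeHLSProfiles.sum_pow_mul_exp_div_nrm_pow_free_scale_le (d := 4) (by norm_num) hε₀ hn1 (p := 1) (by norm_num) 0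
      (S.map (addLeftEmbedding b)) s s
    rw [Finset.sum_map, show (4 - 1 + 2 : ℕ) = 5 by norm_num] at hq
    rw [Finset.sum_map, show (4 - 1 + 0 : ℕ) = 3 by norm_num] at h0
    have hq' : ∑ w ∈ S, (PoissonInterior.supNorm (d := 4) (b + w - s) : ℝ) ^ 2 * prof w s ≤ c₂ * (n : ℝ) ^ 5 := by
      refine le_trans (le_of_eq (Finset.sum_congr rfl fun w _ => ?_)) (hq.trans (le_of_eq (by rw [hc₂])))
      rw [addLeftEmbedding_apply, mul_div_assoc]
    have h0' : ∑ w ∈ S, prof w s ≤ c₀ * (n : ℝ) ^ 3 := by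
      refine le_trans (le_of_eq (Finset.sum_congr rfl fun w _ => ?_)) (h0.trans (le_of_eq (by rw [hc₀])))
      show prof w s = _
      rw [addLeftEmbedding_apply, pow_zero, one_mul]
    calc ∑ w ∈ S, |toReal w μ * toReal w ν| * prof w s
        ≤ ∑ w ∈ S, (2 * (PoissonInterior.supNorm (d := 4) (b + w - s) : ℝ) ^ 2 + 2 * (n : ℝ) ^ 2) * prof w s :=
          Finset.sum_le_sum fun w _ => mul_le_mul_of_nonneg_right (abs_weight_le_of_mem_B n b w s hs μ ν) (hprof0 w s)
      _ = 2 * ∑ w ∈ S, (PoissonInterior.supNorm (d := 4) (b + w - s) : ℝ) ^ 2 * prof w s + 2 * (n : ℝ) ^ 2 * ∑ w ∈ S, prof w s := by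
          rw [Finset.mul_sum, Finset.mul_sum, ← Finset.sum_add_distrib]
          exact Finset.sum_congr rfl fun w _ => by ring
      _ ≤ 2 * (c₂ * (n : ℝ) ^ 5) + 2 * (n : ℝ) ^ 2 * (c₀ * (n : ℝ) ^ 3) :=
          add_le_add (mul_le_mul_of_nonneg_left hq' (by norm_num)) (mul_le_mul_of_nonneg_left h0' (by positivity))
  -- the pointwise domination
  have hdom : ∀ w : Pt, |toReal w μ * toReal w ν * biBubbleTable (Ga n a) (Ga n a) (projPiece n a) (ndlPiece n a cQ) μ ν (b + w) b|
      ≤ ∑ s ∈ B m (blk m b), Wq s * ((1 / 2 * Real.exp δ) * (A₀ * (|toReal w μ * toReal w ν| * E w) + B₀ * (|toReal w μ * toReal w ν| * prof w s))) := by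
    intro w
    have h := abs_projNdl_word_le n a ha hA hKGC hKΦ hK₃ hK₄ hK₅ hK₆ hδ.le hGC hΦ h₃ h₄ h₅ h₆ μ ν b w
    have hw0 : 0 ≤ |toReal w μ * toReal w ν| := abs_nonneg _
    rw [abs_mul]
    refine (mul_le_mul_of_nonneg_left h hw0).trans ?_
    rw [Finset.mul_sum, Finset.mul_sum]
    refine Finset.sum_le_sum fun s _ => ?_
    have hWs : 0 ≤ Wq s := abs_nonneg _
    have hEw : 0 ≤ E w := (Real.exp_pos _).le
    -- `E ≤ 1` on the profile term
    have key : (1 / 2) * Real.exp δ * E w * (Wq s * (A₀ + B₀ * prof w s))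
        ≤ Wq s * ((1 / 2 * Real.exp δ) * (A₀ * E w + B₀ * prof w s)) := by
      have h1 : E w * (B₀ * prof w s) ≤ 1 * (B₀ * prof w s) := mul_le_mul_of_nonneg_right (hE1 w) (mul_nonneg hB₀0 (hprof0 w s))
      nlinarith [mul_nonneg hWs (mul_nonneg (Real.exp_pos δ).le (sub_nonneg.2 h1)), hA₀0, hEw]
    calc |toReal w μ * toReal w ν| * ((1 / 2) * Real.exp δ * E w * (Wq s * (A₀ + B₀ * prof w s)))
        ≤ |toReal w μ * toReal w ν| * (Wq s * ((1 / 2 * Real.exp δ) * (A₀ * E w + B₀ * prof w s))) := mul_le_mul_of_nonneg_left key hw0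
      _ = Wq s * ((1 / 2 * Real.exp δ) * (A₀ * (|toReal w μ * toReal w ν| * E w) + B₀ * (|toReal w μ * toReal w ν| * prof w s))) := by ring
  -- the finite partial sums
  have hfin : ∀ S : Finset Pt, ∑ w ∈ S, |toReal w μ * toReal w ν * biBubbleTable (Ga n a) (Ga n a) (projPiece n a) (ndlPiece n a cQ) μ ν (b + w) b|
      ≤ (∑ s ∈ B m (blk m b), Wq s) * ((1 / 2 * Real.exp δ) * (A₀ * T₁ + B₀ * (2 * (c₂ * (n : ℝ) ^ 5) + 2 * (n : ℝ) ^ 2 * (c₀ * (n : ℝ) ^ 3)))) := by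
    intro S
    calc ∑ w ∈ S, |toReal w μ * toReal w ν * biBubbleTable (Ga n a) (Ga n a) (projPiece n a) (ndlPiece n a cQ) μ ν (b + w) b|
        ≤ ∑ w ∈ S, ∑ s ∈ B m (blk m b), Wq s * ((1 / 2 * Real.exp δ) *
            (A₀ * (|toReal w μ * toReal w ν| * E w) + B₀ * (|toReal w μ * toReal w ν| * prof w s))) := Finset.sum_le_sum fun w _ => hdom w
      _ = ∑ s ∈ B m (blk m b), Wq s * ((1 / 2 * Real.exp δ) *
            (A₀ * ∑ w ∈ S, |toReal w μ * toReal w ν| * E w + B₀ * ∑ w ∈ S, |toReal w μ * toReal w ν| * prof w s)) := by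
          rw [Finset.sum_comm]
          refine Finset.sum_congr rfl fun s _ => ?_
          rw [Finset.mul_sum, Finset.mul_sum, ← Finset.sum_add_distrib, Finset.mul_sum, Finset.mul_sum]
      _ ≤ ∑ s ∈ B m (blk m b), Wq s * ((1 / 2 * Real.exp δ) * (A₀ * T₁ + B₀ * (2 * (c₂ * (n : ℝ) ^ 5) + 2 * (n : ℝ) ^ 2 * (c₀ * (n : ℝ) ^ 3)))) := by
          refine Finset.sum_le_sum fun s hs => mul_le_mul_of_nonneg_left (mul_le_mul_of_nonneg_left (add_le_add
            (mul_le_mul_of_nonneg_left (hS1 S) hA₀0) (mul_le_mul_of_nonneg_left (hS2 S s hs) hB₀0)) (by positivity)) (abs_nonneg _)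
      _ = _ := by rw [Finset.sum_mul]
  have h := (abs_fullSum_le_of_abs_sum_le hfin).2
  refine h.trans (le_of_eq ?_)
  rw [hWq, hA₀, hB₀, hT₁, hc₂, hc₀]


/-! ## §3 The cell: letters instantiated, the census paid at the base average -/

variable {n}

/-- [folklore] **THE BASE-AVERAGE CENSUS** (M7 over the residue sites, root block `0` by `blk_resSite`):
`Σ_{b ∈ image resSite} Σ_{s ∈ B(blk b)} |qJet n ν b (blk b) s| ≤ n − 1`. -/
theorem sum_resSite_needle_weight_le (ν : Fin 4) :
    ∑ b ∈ (univ : Finset (Fin 4 → Fin n)).image resSite, ∑ s ∈ B (n - 1) (blk (n - 1) b), |qJet n ν b (blk (n - 1) b) s| ≤ (n : ℝ) - 1 := by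
  have hn : (0 : ℝ) < n := by exact_mod_cast Nat.pos_of_ne_zero (NeZero.ne n)
  calc ∑ b ∈ (univ : Finset (Fin 4 → Fin n)).image resSite, ∑ s ∈ B (n - 1) (blk (n - 1) b), |qJet n ν b (blk (n - 1) b) s|
      = ∑ b ∈ (univ : Finset (Fin 4 → Fin n)).image resSite, ∑ s ∈ B (n - 1) 0, |qJet n ν b 0 s| := by
        refine Finset.sum_congr rfl fun b hb => ?_
        obtain ⟨r, _, rfl⟩ := Finset.mem_image.1 hb
        rw [blk_resSite]
    _ = ∑ s ∈ B (n - 1) 0, ∑ b ∈ (univ : Finset (Fin 4 → Fin n)).image resSite, |qJet n ν b 0 s| := Finset.sum_comm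
    _ ≤ ∑ _s ∈ B (n - 1) (0 : Pt), ((n : ℝ) - 1) * ((n : ℝ) ^ 4)⁻¹ :=
        Finset.sum_le_sum fun s _ => NeedleBondMarginal.sum_bond_abs_qJet_le n ν _ 0 s
    _ = (n : ℝ) - 1 := by rw [Finset.sum_const, nsmul_eq_mul, card_B, cast_pred_add_one n]; field_simp

/-- [folklore] **«GN-33 ∕ PN»: THE `projPiece ⊗ ndlPiece` CELL OF T₃ IS n-UNIFORM** — the hypothesis `hpn` of `GluonNeedleGlue.h₃_of_cells`, modulo
[B5, Prop. 1.2] ∧ [B5, (1.126)–(1.127)] BY NAME and a uniform bound `cQ₀` on the stencil weight `cQ n` (P13: `C = C(a, cQ₀)`): one `C ≥ 0` with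
`|cellSum n a (projPiece n a) (ndlPiece n a (cQ n)) μ ν| ≤ C` for every `n ≥ 1` (per base site `q_b·n³·G₀`; the base average `n⁻⁴·Σ_b q_b ≤ (n−1)·n⁻⁴` pays the `n³`). -/
theorem exists_projNdl_row_le (ha : 0 < a) (h12 : B5.Prop12Printed (fam nOf hn1 MOf a ha)) (h126 : B5.Kernel126_127Printed (kfam nOf MOf))
    {cQ : ℕ → ℝ} {cQ₀ : ℝ} (hcQ : ∀ n, |cQ n| ≤ cQ₀) (μ ν : Fin 4) :
    ∃ C : ℝ, 0 ≤ C ∧ ∀ (n : ℕ) [NeZero n], |cellSum n a (projPiece n a) (ndlPiece n a (cQ n)) μ ν| ≤ C := by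
  obtain ⟨kGC, δ₂, hδ₂, hkGC, hGC⟩ := exists_applyK_gradC_le a ha h12 h126
  obtain ⟨kΦ, ε₀, hε₀, hkΦ, hΦ⟩ := exists_applyK_grad_row_le a ha h12 h126
  obtain ⟨k₃, δ₃, hδ₃, hk₃, h₃⟩ := exists_pairing_gradC_applyK_colGrad_le a ha h12 h126
  obtain ⟨k₄, δ₄, hδ₄, hk₄, h₄⟩ := exists_pairing_applyK_gradC_rowGrad_le a ha h12 h126
  obtain ⟨k₅, hk₅, h₅⟩ := exists_pairing_grad_row_applyK_colGrad_le a ha h12 h126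
  obtain ⟨k₆, hk₆, h₆⟩ := exists_pairing_applyK_grad_row_rowGrad_le a ha h12 h126
  have hcP := cPPs_nonneg 4 ha; have hcs := cPs_nonneg 4 ha
  have hcQ₀ : 0 ≤ cQ₀ := (abs_nonneg _).trans (hcQ 0)
  set δm : ℝ := min δ₂ (min δ₃ δ₄) with hδm
  have hδm0 : 0 < δm := lt_min hδ₂ (lt_min hδ₃ hδ₄)
  have hm2 : δm ≤ δ₂ := min_le_left _ _
  have hm3 : δm ≤ δ₃ := (min_le_right _ _).trans (min_le_left _ _)
  have hm4 : δm ≤ δ₄ := (min_le_right _ _).trans (min_le_right _ _)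
  set C₁ : ℝ := cQ₀ * cPPs 4 a + cPs 4 a with hC₁
  have hC₁0 : 0 ≤ C₁ := by positivity
  set c₂ : ℝ := 2 * (Nat.factorial 2) * (2 / ε₀) ^ 2 *
    (1 + 2 * (4 : ℕ) * 3 ^ (4 - 1) * ((Nat.factorial (4 - 1 - 1)) * (4 / ε₀) ^ (4 - 1 - 1) * (1 + 4 / ε₀))) with hc₂
  set c₀ : ℝ := 2 * (Nat.factorial 0) * (2 / ε₀) ^ 0 *
    (1 + 2 * (4 : ℕ) * 3 ^ (4 - 1) * ((Nat.factorial (4 - 1 - 1)) * (4 / ε₀) ^ (4 - 1 - 1) * (1 + 4 / ε₀))) with hc₀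
  have hc₂0 : 0 ≤ c₂ := by positivity
  have hc₀0 : 0 ≤ c₀ := by positivity
  have hK := latticeConst_nonneg 4 (half_pos hδm0).le
  set G₀ : ℝ := (1 / 2 * Real.exp δm) * (C₁ * kGC * (k₅ + k₆) * ((1 + 4 / δm) ^ 2 * latticeConst 4 (δm / 2))
    + C₁ * (k₃ + k₄) * kΦ * (2 * c₂ + 2 * c₀)) with hG₀
  have hG₀0 : 0 ≤ G₀ := by positivity
  refine ⟨G₀, hG₀0, fun n _ => ?_⟩
  have hn : (0 : ℝ) < n := by exact_mod_cast Nat.pos_of_ne_zero (NeZero.ne n)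
  have hn1 : (1 : ℝ) ≤ n := by exact_mod_cast NeZero.one_le
  have hA : Spr (Ga n a) := spr_Ga_of_prop12 (a := a) (ha := ha) h12 h126 n
  have hC₀ : |cQ n| * cPPs 4 a + cPs 4 a ≤ C₁ := by rw [hC₁]; exact add_le_add (mul_le_mul_of_nonneg_right (hcQ n) hcP) le_rfl
  have hexpm : ∀ {δ' : ℝ} (_ : δm ≤ δ') (t : ℝ), 0 ≤ t → Real.exp (-(δ' * t)) ≤ Real.exp (-(δm * t)) := fun hle t ht =>
    Real.exp_le_exp.2 (neg_le_neg (mul_le_mul_of_nonneg_right hle ht))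
  have hGCn : ∀ (u x : Pt) (α : Fin 4), |applyK (Ga n a) (grad (fun q => cQ n * (∑ z ∈ B (n - 1) (blk (n - 1) u), Pgt n a z q () ())
      - kerP (d := 4) (n - 1) a q (blk (n - 1) u))) x α| ≤ C₁ * kGC * (n : ℝ) * Real.exp (-(δm * dist (blk (n - 1) x) (blk (n - 1) u))) :=
    fun u x α => (hGC n (cQ n) u x α).trans (by
      rw [mul_comm kGC (|cQ n| * cPPs 4 a + cPs 4 a)]
      exact mul_le_mul (mul_le_mul_of_nonneg_right (mul_le_mul_of_nonneg_right hC₀ hkGC) hn.le)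
        (hexpm hm2 _ dist_nonneg) (Real.exp_pos _).le (by positivity))
  have h₃n : ∀ (u q : Pt), |pairing (grad (fun q' => cQ n * (∑ z ∈ B (n - 1) (blk (n - 1) u), Pgt n a z q' () ())
      - kerP (d := 4) (n - 1) a q' (blk (n - 1) u))) (applyK (Ga n a) (colGrad (Pgt n a) q))|
      ≤ C₁ * k₃ * Real.exp (-(δm * dist (blk (n - 1) q) (blk (n - 1) u))) :=
    fun u q => (h₃ n (cQ n) u q).trans (by
      rw [mul_comm k₃ (|cQ n| * cPPs 4 a + cPs 4 a), dist_comm (blk (n - 1) u) (blk (n - 1) q)]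
      exact mul_le_mul (mul_le_mul_of_nonneg_right hC₀ hk₃) (hexpm hm3 _ dist_nonneg) (Real.exp_pos _).le (by positivity))
  have h₄n : ∀ (u p : Pt), |pairing (applyK (Ga n a) (grad (fun q' => cQ n * (∑ z ∈ B (n - 1) (blk (n - 1) u), Pgt n a z q' () ())
      - kerP (d := 4) (n - 1) a q' (blk (n - 1) u)))) (rowGrad (Pgt n a) p)|
      ≤ C₁ * k₄ * Real.exp (-(δm * dist (blk (n - 1) p) (blk (n - 1) u))) :=
    fun u p => (h₄ n (cQ n) u p).trans (by
      rw [mul_comm k₄ (|cQ n| * cPPs 4 a + cPs 4 a), dist_comm (blk (n - 1) u) (blk (n - 1) p)]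
      exact mul_le_mul (mul_le_mul_of_nonneg_right hC₀ hk₄) (hexpm hm4 _ dist_nonneg) (Real.exp_pos _).le (by positivity))
  -- the n-power identity at the base placement: `G_n = n³·G₀`
  have hGn : (1 / 2 * Real.exp δm) * (((k₅ / (n : ℝ) ^ 4 + k₆ / (n : ℝ) ^ 4) * (C₁ * kGC * (n : ℝ))) * ((n : ℝ) ^ 2 * ((1 + 4 / δm) ^ 2 *
        ((n : ℝ) ^ 4 * latticeConst 4 (δm / 2)))) + ((C₁ * k₃ + C₁ * k₄) * (kΦ / (n : ℝ) ^ 2)) * (2 * (c₂ * (n : ℝ) ^ 5) + 2 * (n : ℝ) ^ 2 * (c₀ * (n : ℝ) ^ 3)))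
      = (n : ℝ) ^ 3 * G₀ := by
    rw [hG₀]; field_simp
  -- one base site
  have hsite : ∀ b : Pt, |fullSum (fun w : Pt => toReal w μ * toReal w ν *
      biBubbleTable (Ga n a) (Ga n a) (projPiece n a) (ndlPiece n a (cQ n)) μ ν (b + w) b)|
      ≤ (∑ s ∈ B (n - 1) (blk (n - 1) b), |qJet n ν b (blk (n - 1) b) s|) * ((n : ℝ) ^ 3 * G₀) := by
    intro b
    have h := abs_fullSum_projNdl_le n a ha hA (KGC := C₁ * kGC * (n : ℝ)) (KΦ := kΦ / (n : ℝ) ^ 2) (K₃ := C₁ * k₃) (K₄ := C₁ * k₄)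
      (K₅ := k₅ / (n : ℝ) ^ 4) (K₆ := k₆ / (n : ℝ) ^ 4) (by positivity) (by positivity) (by positivity) (by positivity) (by positivity)
      (by positivity) hδm0 hε₀ hGCn (hΦ n) h₃n h₄n (h₅ n) (h₆ n) μ ν b
    rw [← hc₂, ← hc₀, hGn] at h
    exact h
  -- the base average pays the census
  rw [cellSum_def]
  refine (Finset.abs_sum_le_sum_abs _ _).trans ?_
  have hq := sum_resSite_needle_weight_le (n := n) ν
  calc ∑ b ∈ (univ : Finset (Fin 4 → Fin n)).image resSite, |((n : ℝ) ^ 4)⁻¹ *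
        fullSum (fun w : Pt => toReal w μ * toReal w ν * biBubbleTable (Ga n a) (Ga n a) (projPiece n a) (ndlPiece n a (cQ n)) μ ν (b + w) b)|
      ≤ ∑ b ∈ (univ : Finset (Fin 4 → Fin n)).image resSite, ((n : ℝ) ^ 4)⁻¹ *
          ((∑ s ∈ B (n - 1) (blk (n - 1) b), |qJet n ν b (blk (n - 1) b) s|) * ((n : ℝ) ^ 3 * G₀)) := by
        refine Finset.sum_le_sum fun b _ => ?_
        rw [abs_mul, abs_of_nonneg (by positivity : (0 : ℝ) ≤ ((n : ℝ) ^ 4)⁻¹)]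
        exact mul_le_mul_of_nonneg_left (hsite b) (by positivity)
    _ = ((n : ℝ) ^ 4)⁻¹ * ((n : ℝ) ^ 3 * G₀) *
          ∑ b ∈ (univ : Finset (Fin 4 → Fin n)).image resSite, ∑ s ∈ B (n - 1) (blk (n - 1) b), |qJet n ν b (blk (n - 1) b) s| := by
        rw [Finset.mul_sum]; exact Finset.sum_congr rfl fun b _ => by ring
    _ ≤ ((n : ℝ) ^ 4)⁻¹ * ((n : ℝ) ^ 3 * G₀) * ((n : ℝ) - 1) := mul_le_mul_of_nonneg_left hq (by positivity)
    _ = (((n : ℝ) - 1) / (n : ℝ)) * G₀ := by field_simp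
    _ ≤ 1 * G₀ := mul_le_mul_of_nonneg_right ((div_le_one hn).2 (sub_le_self _ zero_le_one)) hG₀0
    _ = G₀ := one_mul _

end Summit.QuantumFields.BalabanUV.Beta.D1BFx.NeedleProjNdlRow

end
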